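/-
Copyright: the b2b-balaban T⁴-continuum CRUX team, row NE7b OWNER lineage `t4-ne7b-p1` (gen 138). Project licence.
-/
import Mathlib.Analysis.InnerProductSpace.PiL2
import Mathlib.Analysis.SpecialFunctions.Pow.Real
import Mathlib.Algebra.Order.BigOperators.Group.Finset

/-!
# THE CANONICAL RESCALING `A = t • J_β`: the BLOCK-CONSTANT INJECTION `(J_β v)(x) = v(β x)` of next-scale fields along a block map
# `β : ι → ι′` whose fibres have at most `n` sites, times the field normalisation `t` — its two structure constants for the rescaling
# letter map (428) are the BLOCK TRANSFER constant `c = t²·n` (`Σ_{x∈Y}(Av)_x² ≤ t²n·Σ_{y∈Y′}v_y²` when `β(Y) ⊆ Y′`) and the operator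
# norm `‖A‖ ≤ |t|·√n` (so `‖A‖² ≤ t²n`, `‖A‖³ ≤ |t|³n√n`); `A` is local from `Y′` to `Y`; and at the CANONICAL exponents `n = L^d`,
# `t = L^{−(d−2)∕2}` every quadratic factor is `t²n = L²` IN EVERY DIMENSION (the `Σ`-letters and `κ₂, λ, Λ` are MASS-TYPE: relevant
# with exponent `2`), the cubic factor is `L³` — SCOPING (d9)(1), second half (row NE7b, node U5c; Mathlib only; [folklore])

Cell `pub-balaban`, sub-cell `t4`, spine estimate NE7b (`T4WeightBudget.RelWeightBound`; the cell's OWN estimate — NOT PRINTED in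
[Bałaban 1983–89], NOT PROVED).  Crux-route work under `Spine/NE7b/` by the row OWNER (`t4-ne7b-p1` gen 138, file (429)) under FREEZE
(0)'s crux-prover clause; NOTHING of Bałaban's is named as a Lean object, valued or asserted; no `T4Continuum/Support` leaf typed; no
`def`, no notation; zero `sorry`.  Imports: Mathlib only (fast lane); (428) `…SupBlockRescalingLetters` is met BY SHAPE (its `A`, `c`,
`hAY`, `hAloc` are produced here for `A = t • J_β`), not imported.

WHY (SCOPING-d9 (1)).  (428) transports the nine letters of the `Y`-local block class through an arbitrary continuous linear `A` with
the factors `c` (for `κ₀`, `Λ`, growth), `‖A‖²` (for `κ₂`, `λ`), `‖A‖³` (for `κ₃`), `‖A‖·max(1,c)` (for `κ₁`).  The rescaling of one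
renormalisation step reads the next field `v` on the coarse sites `ι′` as the background `A v` on the current sites `ι`: the coarse
value copied to every site of its block (`J_β`, `β x` = the block of `x`) times the normalisation `t` of the field (`t = L^{−[φ]}`,
`[φ] = (d−2)∕2` canonical).  THIS FILE computes `c` and `‖A‖` for that `A`, exactly (`Σ_{x∈Y} v(βx)² = Σ_{y∈Y′} #(Y ∩ β⁻¹y)·v_y²`) and
as the bounds (428) consumes, and evaluates them at the canonical exponents: `t²n = L^{−(d−2)}·L^d = L²` for EVERY `d` — the factor by
which every quadratic letter of the class is multiplied per rescaling, i.e. the letters `κ₀, κ₂, Λ, λ` (bounds of MASS type: `Σφ²`,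
`‖U″‖`) are RELEVANT with exponent `2`, independently of the dimension; the cubic letter's factor `‖A‖³ = L³` (against power counting's
`L^{d−3[φ]} = L` at `d = 4`, the operator norm not seeing the locality of `U` inside its block).  The fixed-ball test of the COMBINED map
(fluctuation (427) ∘ rescaling (428)+(429)) is the next file (430).

WHAT IS PROVED ([folklore]; `β : ι → ι′` any map of finite types, `J_β := (EuclideanSpace.equiv ι ℝ).symm ∘L (ContinuousLinearMap.pi
fun x ↦ EuclideanSpace.proj (β x))` written out, `A := t • J_β`):
* §1 `blockInj_apply` (`(J_β v) x = v (β x)`), `smul_blockInj_apply` (`(A v) x = t·v(βx)`).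
* §2 FIBRE SUMS: `sum_comp_fiberwise` (`Σ_{x∈Y} g(βx) = Σ_{y∈Y′} #(Y with βx = y)·g y` for `β(Y) ⊆ Y′`), `sum_comp_le` (`≤ n·Σ_{Y′} g` for
  `g ≥ 0` and fibres in `Y` of size `≤ n`).
* §3 BLOCK TRANSFER: `blockTransfer_eq` (exact), `blockTransfer_le` (`Σ_{x∈Y}(Av)_x² ≤ (t²n)·Σ_{y∈Y′}v_y²` — (428)'s `hAY` with `c = t²n`).
* §4 NORMS: `norm_sq_blockInj_le` (`‖J_β v‖² ≤ n‖v‖²`), `norm_blockInj_le` (`‖J_β‖ ≤ √n`), `norm_smul_blockInj_le` (`‖A‖ ≤ |t|√n`),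
  `norm_sq_smul_blockInj_le` (`‖A‖² ≤ t²n`), `norm_cube_smul_blockInj_le` (`‖A‖³ ≤ |t|³·(n·√n)`).
* §5 LOCALITY: `blockInj_local` ((428)'s `hAloc` for `β(Y) ⊆ Y′`).
* §6 CANONICAL EXPONENTS (real arithmetic, `L > 0`): `canonical_quadratic_factor` (`(L^{−(d−2)∕2})²·L^d = L²`, real powers, every `d : ℕ`),
  `canonical_factors_dim4` (`d = 4`: `t = L⁻¹`, `n = L⁴`: `t²n = L²`, `|t|·√n = L`, `|t|³·(n√n) = L³`).
* §7 toy (kernel): two fine sites over one coarse site (`β : Fin 2 → Fin 1`): `(J v) x = v 0`.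

HONEST (what this is NOT).  No letter is composed here ((430) does the combined map and its fixed-ball test); the smoother injections of
print (minimisers of the kinetic form under the block constraint) have the SAME quadratic factor up to constants and are not typed; which
normalisation `t` print uses ((A3) ∕ (A1c), NC-NE7b-α UNRULED) is not decided — §6 only records that the canonical one makes every quadratic
letter grow by `L²`.  (β3′) multi-block and (β4) extraction NOT touched; scalar skeleton; nothing of Bałaban's asserted.  BY-NAME EFFECT ON THE
WALL: NONE.  NE7b NOT PRINTED ∕ NOT PROVED; spine PROVED 0∕9; rung (B)+1 — the programme's measures remain FINITE-torus statements; NOT the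
mass gap, NOT Clay.  HONEST DEPENDENCY: continuum YM on T⁴ ⇐ BetaPertH ∧ nine spine estimates (0∕9 proved); BetaPertH ⇐ (D1) ∧ (D4) ∧
CAP+tail; G-an2-4 gates asym, D1 and NE2∕3∕4.
-/

set_option autoImplicit false

noncomputable section

namespace Summit.QuantumFields.BalabanUV.T4Continuum.NE7b.SupBlockInjectionScaling

open Finset Real
open scoped BigOperators

variable {ι ι' : Type} [Fintype ι] [Fintype ι'] [DecidableEq ι']

/-! ## §1. The block-constant injection -/

omit [Fintype ι] [Fintype ι'] [DecidableEq ι'] in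
/-- `(J_β v) x = v (β x)`: the block-constant injection copies the coarse value to every site of its block. [folklore] -/
@[simp]
theorem blockInj_apply (β : ι → ι') (v : EuclideanSpace ℝ ι') (x : ι) :
    ((((EuclideanSpace.equiv ι ℝ).symm : (ι → ℝ) →L[ℝ] EuclideanSpace ℝ ι).comp
        (ContinuousLinearMap.pi fun x : ι => (EuclideanSpace.proj (β x) : EuclideanSpace ℝ ι' →L[ℝ] ℝ))) v) x = v (β x) :=
  rfl

omit [Fintype ι'] [DecidableEq ι'] in
/-- `((t • J_β) v) x = t·v(β x)`. [folklore] -/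
@[simp]
theorem smul_blockInj_apply (β : ι → ι') (t : ℝ) (v : EuclideanSpace ℝ ι') (x : ι) :
    ((t • (((EuclideanSpace.equiv ι ℝ).symm : (ι → ℝ) →L[ℝ] EuclideanSpace ℝ ι).comp
        (ContinuousLinearMap.pi fun x : ι => (EuclideanSpace.proj (β x) : EuclideanSpace ℝ ι' →L[ℝ] ℝ)))) v) x = t * v (β x) :=
  rfl

/-! ## §2. Fibre sums -/

omit [Fintype ι] [Fintype ι'] in
/-- `Σ_{x∈Y} g(βx) = Σ_{y∈Y′} #(Y with βx = y)·g(y)` when `β(Y) ⊆ Y′`. [folklore] -/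
theorem sum_comp_fiberwise (β : ι → ι') (Y : Finset ι) (Y' : Finset ι') (hβ : ∀ x ∈ Y, β x ∈ Y') (g : ι' → ℝ) :
    ∑ x ∈ Y, g (β x) = ∑ y ∈ Y', ((Y.filter fun x => β x = y).card : ℝ) * g y := by
  rw [← Finset.sum_fiberwise_of_maps_to' hβ]
  refine Finset.sum_congr rfl fun y _ => ?_
  rw [Finset.sum_const, nsmul_eq_mul]

omit [Fintype ι] [Fintype ι'] in
/-- `Σ_{x∈Y} g(βx) ≤ n·Σ_{y∈Y′} g(y)` for `g ≥ 0` when `β(Y) ⊆ Y′` and every fibre of `β` inside `Y` has at most `n` sites. [folklore] -/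
theorem sum_comp_le (β : ι → ι') (Y : Finset ι) (Y' : Finset ι') (hβ : ∀ x ∈ Y, β x ∈ Y') {n : ℕ}
    (hfib : ∀ y, (Y.filter fun x => β x = y).card ≤ n) (g : ι' → ℝ) (hg : ∀ y, 0 ≤ g y) :
    ∑ x ∈ Y, g (β x) ≤ (n : ℝ) * ∑ y ∈ Y', g y := by
  rw [sum_comp_fiberwise β Y Y' hβ g, Finset.mul_sum]
  refine Finset.sum_le_sum fun y _ => ?_
  exact mul_le_mul_of_nonneg_right (by exact_mod_cast hfib y) (hg y)

/-! ## §3. Block transfer -/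

omit [Fintype ι'] in
/-- **EXACT BLOCK TRANSFER**: `Σ_{x∈Y}((t•J_β)v)_x² = t²·Σ_{y∈Y′} #(Y with βx = y)·v_y²` when `β(Y) ⊆ Y′`. [folklore] -/
theorem blockTransfer_eq (β : ι → ι') (Y : Finset ι) (Y' : Finset ι') (hβ : ∀ x ∈ Y, β x ∈ Y') (t : ℝ) (v : EuclideanSpace ℝ ι') :
    ∑ x ∈ Y, ((t • (((EuclideanSpace.equiv ι ℝ).symm : (ι → ℝ) →L[ℝ] EuclideanSpace ℝ ι).comp
        (ContinuousLinearMap.pi fun x : ι => (EuclideanSpace.proj (β x) : EuclideanSpace ℝ ι' →L[ℝ] ℝ)))) v) x ^ 2 =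
      t ^ 2 * ∑ y ∈ Y', ((Y.filter fun x => β x = y).card : ℝ) * v y ^ 2 := by
  simp only [smul_blockInj_apply, mul_pow]
  rw [← Finset.mul_sum, sum_comp_fiberwise β Y Y' hβ (fun y => v y ^ 2)]

omit [Fintype ι'] in
/-- **BLOCK TRANSFER, THE LETTER (428) CONSUMES**: `Σ_{x∈Y}((t•J_β)v)_x² ≤ (t²n)·Σ_{y∈Y′}v_y²` when `β(Y) ⊆ Y′` and the fibres in `Y`
have at most `n` sites — `hAY` with `c = t²n`. [folklore] -/
theorem blockTransfer_le (β : ι → ι') (Y : Finset ι) (Y' : Finset ι') (hβ : ∀ x ∈ Y, β x ∈ Y') {n : ℕ}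
    (hfib : ∀ y, (Y.filter fun x => β x = y).card ≤ n) (t : ℝ) :
    ∀ v : EuclideanSpace ℝ ι', ∑ x ∈ Y, ((t • (((EuclideanSpace.equiv ι ℝ).symm : (ι → ℝ) →L[ℝ] EuclideanSpace ℝ ι).comp
        (ContinuousLinearMap.pi fun x : ι => (EuclideanSpace.proj (β x) : EuclideanSpace ℝ ι' →L[ℝ] ℝ)))) v) x ^ 2 ≤
      (t ^ 2 * n) * ∑ y ∈ Y', v y ^ 2 := by
  intro v
  simp only [smul_blockInj_apply, mul_pow]
  rw [← Finset.mul_sum, mul_assoc]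
  exact mul_le_mul_of_nonneg_left (sum_comp_le β Y Y' hβ hfib (fun y => v y ^ 2) fun y => sq_nonneg _) (sq_nonneg t)

/-! ## §4. Norms -/

/-- `‖J_β v‖² ≤ n·‖v‖²` when every fibre of `β` has at most `n` sites. [folklore] -/
theorem norm_sq_blockInj_le (β : ι → ι') {n : ℕ} (hfib : ∀ y, (Finset.univ.filter fun x => β x = y).card ≤ n) (v : EuclideanSpace ℝ ι') :
    ‖(((EuclideanSpace.equiv ι ℝ).symm : (ι → ℝ) →L[ℝ] EuclideanSpace ℝ ι).comp
        (ContinuousLinearMap.pi fun x : ι => (EuclideanSpace.proj (β x) : EuclideanSpace ℝ ι' →L[ℝ] ℝ))) v‖ ^ 2 ≤ (n : ℝ) * ‖v‖ ^ 2 := by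
  rw [EuclideanSpace.real_norm_sq_eq, EuclideanSpace.real_norm_sq_eq]
  simp only [blockInj_apply]
  exact sum_comp_le β Finset.univ Finset.univ (fun x _ => Finset.mem_univ _) hfib (fun y => v y ^ 2) fun y => sq_nonneg _

/-- **`‖J_β‖ ≤ √n`** when every fibre of `β` has at most `n` sites. [folklore] -/
theorem norm_blockInj_le (β : ι → ι') {n : ℕ} (hfib : ∀ y, (Finset.univ.filter fun x => β x = y).card ≤ n) :
    ‖((EuclideanSpace.equiv ι ℝ).symm : (ι → ℝ) →L[ℝ] EuclideanSpace ℝ ι).comp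
        (ContinuousLinearMap.pi fun x : ι => (EuclideanSpace.proj (β x) : EuclideanSpace ℝ ι' →L[ℝ] ℝ))‖ ≤ Real.sqrt n := by
  refine ContinuousLinearMap.opNorm_le_bound _ (Real.sqrt_nonneg _) fun v => ?_
  have h := norm_sq_blockInj_le β hfib v
  have h2 : (Real.sqrt n * ‖v‖) ^ 2 = (n : ℝ) * ‖v‖ ^ 2 := by
    rw [mul_pow, Real.sq_sqrt (Nat.cast_nonneg n)]
  rw [← h2] at h
  exact le_of_pow_le_pow_left₀ two_ne_zero (by positivity) h

/-- **`‖t • J_β‖ ≤ |t|·√n`**. [folklore] -/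
theorem norm_smul_blockInj_le (β : ι → ι') {n : ℕ} (hfib : ∀ y, (Finset.univ.filter fun x => β x = y).card ≤ n) (t : ℝ) :
    ‖t • (((EuclideanSpace.equiv ι ℝ).symm : (ι → ℝ) →L[ℝ] EuclideanSpace ℝ ι).comp
        (ContinuousLinearMap.pi fun x : ι => (EuclideanSpace.proj (β x) : EuclideanSpace ℝ ι' →L[ℝ] ℝ)))‖ ≤ |t| * Real.sqrt n := by
  rw [norm_smul, Real.norm_eq_abs]
  exact mul_le_mul_of_nonneg_left (norm_blockInj_le β hfib) (abs_nonneg t)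

/-- **`‖t • J_β‖² ≤ t²·n`** — the factor of (428)'s letters `κ₂`, `λ`. [folklore] -/
theorem norm_sq_smul_blockInj_le (β : ι → ι') {n : ℕ} (hfib : ∀ y, (Finset.univ.filter fun x => β x = y).card ≤ n) (t : ℝ) :
    ‖t • (((EuclideanSpace.equiv ι ℝ).symm : (ι → ℝ) →L[ℝ] EuclideanSpace ℝ ι).comp
        (ContinuousLinearMap.pi fun x : ι => (EuclideanSpace.proj (β x) : EuclideanSpace ℝ ι' →L[ℝ] ℝ)))‖ ^ 2 ≤ t ^ 2 * n := by
  have h := norm_smul_blockInj_le β hfib t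
  have h2 : (|t| * Real.sqrt n) ^ 2 = t ^ 2 * n := by
    rw [mul_pow, sq_abs, Real.sq_sqrt (Nat.cast_nonneg n)]
  rw [← h2]
  exact pow_le_pow_left₀ (norm_nonneg _) h 2

/-- **`‖t • J_β‖³ ≤ |t|³·(n·√n)`** — the factor of (428)'s letter `κ₃`. [folklore] -/
theorem norm_cube_smul_blockInj_le (β : ι → ι') {n : ℕ} (hfib : ∀ y, (Finset.univ.filter fun x => β x = y).card ≤ n) (t : ℝ) :
    ‖t • (((EuclideanSpace.equiv ι ℝ).symm : (ι → ℝ) →L[ℝ] EuclideanSpace ℝ ι).comp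
        (ContinuousLinearMap.pi fun x : ι => (EuclideanSpace.proj (β x) : EuclideanSpace ℝ ι' →L[ℝ] ℝ)))‖ ^ 3 ≤ |t| ^ 3 * ((n : ℝ) * Real.sqrt n) := by
  have h := norm_smul_blockInj_le β hfib t
  have h2 : (|t| * Real.sqrt n) ^ 3 = |t| ^ 3 * ((n : ℝ) * Real.sqrt n) := by
    have hs : Real.sqrt n ^ 3 = (n : ℝ) * Real.sqrt n := by
      rw [pow_succ, Real.sq_sqrt (Nat.cast_nonneg n)]
    rw [mul_pow, hs]
  rw [← h2]
  exact pow_le_pow_left₀ (norm_nonneg _) h 3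

/-! ## §5. Locality -/

omit [Fintype ι'] [DecidableEq ι'] in
/-- **`t • J_β` is local from `Y′` to `Y`** when `β(Y) ⊆ Y′`: `v = v′` on `Y′ ⟹ (t•J_β)v = (t•J_β)v′` on `Y` — (428)'s `hAloc`. [folklore] -/
theorem blockInj_local (β : ι → ι') (Y : Finset ι) (Y' : Finset ι') (hβ : ∀ x ∈ Y, β x ∈ Y') (t : ℝ) :
    ∀ v v' : EuclideanSpace ℝ ι', (∀ y ∈ Y', v y = v' y) → ∀ x ∈ Y,
      ((t • (((EuclideanSpace.equiv ι ℝ).symm : (ι → ℝ) →L[ℝ] EuclideanSpace ℝ ι).comp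
        (ContinuousLinearMap.pi fun x : ι => (EuclideanSpace.proj (β x) : EuclideanSpace ℝ ι' →L[ℝ] ℝ)))) v) x =
      ((t • (((EuclideanSpace.equiv ι ℝ).symm : (ι → ℝ) →L[ℝ] EuclideanSpace ℝ ι).comp
        (ContinuousLinearMap.pi fun x : ι => (EuclideanSpace.proj (β x) : EuclideanSpace ℝ ι' →L[ℝ] ℝ)))) v') x := by
  intro v v' hv x hx
  rw [smul_blockInj_apply, smul_blockInj_apply, hv (β x) (hβ x hx)]

/-! ## §6. The canonical exponents -/

/-- **THE CANONICAL QUADRATIC FACTOR IS `L²` IN EVERY DIMENSION**: with `n = L^d` sites per block and the canonical field normalisation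
`t = L^{−(d−2)∕2}`, the factor `t²·n` of every quadratic letter (`κ₀`, `κ₂`, `Λ`, `λ`) equals `L²` (`L > 0`, any `d : ℕ`; real powers). [folklore] -/
theorem canonical_quadratic_factor {L : ℝ} (hL : 0 < L) (d : ℕ) :
    (L ^ (-(((d : ℝ) - 2) / 2))) ^ 2 * L ^ (d : ℝ) = L ^ 2 := by
  have h1 : (L ^ (-(((d : ℝ) - 2) / 2))) ^ 2 = L ^ (-(((d : ℝ) - 2) / 2) * 2) := by
    rw [Real.rpow_mul hL.le, Real.rpow_two]
  rw [h1, ← Real.rpow_add hL]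
  have h2 : -(((d : ℝ) - 2) / 2) * 2 + (d : ℝ) = 2 := by ring
  rw [h2, Real.rpow_two]

/-- **THE CANONICAL FACTORS AT `d = 4`** (`t = L⁻¹`, `n = L⁴`, plain arithmetic): `t²n = L²`, `|t|·√n = L`, `|t|³·(n√n) = L³` (`L > 0`). [folklore] -/
theorem canonical_factors_dim4 {L : ℝ} (hL : 0 < L) :
    (L⁻¹) ^ 2 * L ^ 4 = L ^ 2 ∧ |L⁻¹| * Real.sqrt (L ^ 4) = L ∧ |L⁻¹| ^ 3 * (L ^ 4 * Real.sqrt (L ^ 4)) = L ^ 3 := by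
  have hs : Real.sqrt (L ^ 4) = L ^ 2 := by
    rw [show L ^ 4 = (L ^ 2) ^ 2 by ring, Real.sqrt_sq (by positivity)]
  have ha : |L⁻¹| = L⁻¹ := abs_of_pos (inv_pos.2 hL)
  have hL0 : L ≠ 0 := hL.ne'
  refine ⟨?_, ?_, ?_⟩
  · field_simp
  · rw [ha, hs]; field_simp
  · rw [ha, hs]; field_simp

/-! ## §7. Toy -/

/-- Toy (kernel): two fine sites over one coarse site, `β : Fin 2 → Fin 1` constant; the injection copies `v 0` to both sites. -/
example (v : EuclideanSpace ℝ (Fin 1)) (x : Fin 2) :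
    ((((EuclideanSpace.equiv (Fin 2) ℝ).symm : (Fin 2 → ℝ) →L[ℝ] EuclideanSpace ℝ (Fin 2)).comp
        (ContinuousLinearMap.pi fun x : Fin 2 => (EuclideanSpace.proj ((fun _ : Fin 2 => (0 : Fin 1)) x) : EuclideanSpace ℝ (Fin 1) →L[ℝ] ℝ))) v) x =
      v 0 :=
  blockInj_apply (fun _ : Fin 2 => (0 : Fin 1)) v x

end Summit.QuantumFields.BalabanUV.T4Continuum.NE7b.SupBlockInjectionScaling

end
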